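import Summits.Ventures.WeilGRH.DoubleReflectionTransfer
import Summits.Ventures.WeilGRH.ThirdPrimeReflectionRungs
import HarnessLib

/-!
# GRH arm (rh-explicit, venture WeilGRH): the rungs `59/100` and `log 2` by the DOUBLE reflection

Instances of `weilPositivityOnChar_transfer_double_reflection` (`DoubleReflectionTransfer.lean`: both primes
`2` and `3` reflected, convex combination of the two one-prime certificates with budgets `B₂ + B₃ ≤ B ≤ log q`
and weights `t₂ + t₃ ≥ 2`) at the two `ζ` rungs of the two-prime window that are kernel-checked in the tree,
`weilPositivityOn_59_100` (R2c) and `EvenWinsBeyondArch.weilPositivityOn_log_two` (R4a), with the rational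
constant bounds already in the tree (`fiftynine_constants`, `fiftynine_constants_three`, `log_two_constants`,
`log_two_constants_three`, `kprime_bounds`, `kthree_ge/le`).

UNIFORM STATEMENTS (every Dirichlet character, primitive or not, any parity):
* `weilPositivityOnChar_fiftynine_of_ge_twelve`: **`WeilPositivityOnChar χ (59/100)` for EVERY `χ` mod
  `q ≥ 12`** (one-sided reflections: `q ≥ 32`, `ThirdPrimeReflectionRungs`); `12` is sharp for the method:
  a character with `χ(2) = χ(3) = 1` gains nothing from the primes and needs `log q ≥ 2(sinh a + a) = 2.4297`.
* `weilPositivityOnChar_log_two_of_ge_eighteen`: **`WeilPositivityOnChar χ (log 2)` for EVERY `χ` mod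
  `q ≥ 18`** (was `q ≥ 50`); again sharp for the method (`2(3/4 + log 2) = 2.8863 ≤ log 18 = 2.8904`).

PER-CLASS STATEMENTS below the uniform thresholds, keyed by the two values `‖1 − χ(2)‖²`, `‖1 − χ(3)‖²`
(boxes) or by `χ(n) = 0` (even / `3 ∣ q` moduli), to be discharged for the named census characters of
conductor `≤ 20` from `ConreyRowBridge`: at `59/100` the classes `8.3, 8.5, 9.4, 11.3, 11.5, 11.7`; at
`log 2` the classes `8.5, 11.5, 12.11, 13.3, 13.6, 15.2, 15.14, 16.3/16.5, 17.2, 17.3, 17.4, 17.5, 17.8,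
17.10, 17.11`. With the earlier files this makes, among the 46 conjugacy classes of primitive characters of
conductor `≤ 20`, 37 classes PROVED at `59/100` and 31 at `log 2` (exact two-prime secular value: 39 / 36;
with the parity bonus: 43 / 43 — rh-explicit-weil-grh-2 gen3 numerics, `work/py/convex_combo.py`,
parameters chosen and checked in exact rational arithmetic by `work/py/lean_params2.py`).

## References

* A. Weil (1952), (11) and the «lemme» p. 262; H. Yoshida (1992) §6.
-/

noncomputable section

open Complex Filter Set MeasureTheory
open scoped Real Topology ComplexConjugate

namespace Summit.Ventures.WeilGRH

open Literature.NumberTheory.LFunctions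

/-! ## The cleared criterion with a weight `t`: monotonicity and interpolation -/

/-- The weighted cleared criterion is monotone in its ingredients: upper bounds for `C_M, C_A`, a lower
bound for `I_A`, two-sided bounds for `k'` and a rational check imply it (`t ≥ 0`). [folklore] -/
theorem cleared_criterion_of_bounds {t CM CA IA k ρ σ B CMu CAu IAl kl ku : ℝ}
    (hCM : CM ≤ CMu) (hCA : CA ≤ CAu) (hIA : IAl ≤ IA) (hIAl : 0 ≤ IAl) (hρ : 0 ≤ ρ)
    (hσ : 0 ≤ σ) (hkl : kl ≤ k) (hku : k ≤ ku) (hkl0 : 0 ≤ kl) (hB : 0 < B) (hCMu : 0 ≤ CMu)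
    (ht : 0 ≤ t) (hBk : ku ^ 2 * σ ≤ B ^ 2)
    (hnum : t * (CMu * (B ^ 2 - kl ^ 2 * σ) + 2 * B * (B * CAu - kl * ρ * IAl)) ≤
      B * (B ^ 2 - ku ^ 2 * σ)) :
    t * (CM * (B ^ 2 - k ^ 2 * σ) + 2 * B * (B * CA - k * ρ * IA)) ≤ B * (B ^ 2 - k ^ 2 * σ) := by
  have hk0 : 0 ≤ k := hkl0.trans hkl
  have e1 : k ^ 2 * σ ≤ ku ^ 2 * σ :=
    mul_le_mul_of_nonneg_right (pow_le_pow_left₀ hk0 hku 2) hσ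
  have e2 : kl ^ 2 * σ ≤ k ^ 2 * σ :=
    mul_le_mul_of_nonneg_right (pow_le_pow_left₀ hkl0 hkl 2) hσ
  have e3 : CM * (B ^ 2 - k ^ 2 * σ) ≤ CMu * (B ^ 2 - k ^ 2 * σ) :=
    mul_le_mul_of_nonneg_right hCM (by linarith)
  have e4 : CMu * (B ^ 2 - k ^ 2 * σ) ≤ CMu * (B ^ 2 - kl ^ 2 * σ) :=
    mul_le_mul_of_nonneg_left (by linarith) hCMu
  have e5 : kl * ρ * IAl ≤ k * ρ * IA :=
    mul_le_mul (mul_le_mul_of_nonneg_right hkl hρ) hIA hIAl (mul_nonneg hk0 hρ)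
  have e6 : B * CA ≤ B * CAu := mul_le_mul_of_nonneg_left hCA hB.le
  have e7 : 2 * B * (B * CA - k * ρ * IA) ≤ 2 * B * (B * CAu - kl * ρ * IAl) :=
    mul_le_mul_of_nonneg_left (by linarith) (by linarith)
  have e8 : B * (B ^ 2 - ku ^ 2 * σ) ≤ B * (B ^ 2 - k ^ 2 * σ) :=
    mul_le_mul_of_nonneg_left (by linarith) hB.le
  have hbr : CM * (B ^ 2 - k ^ 2 * σ) + 2 * B * (B * CA - k * ρ * IA) ≤
      CMu * (B ^ 2 - kl ^ 2 * σ) + 2 * B * (B * CAu - kl * ρ * IAl) := by linarith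
  have e9 := mul_le_mul_of_nonneg_left hbr ht
  linarith

/-- On the curve `ρ = σ/2` the weighted bounded criterion is affine in `σ`, and it improves with `ρ`: if it
holds at `σ₀` and `σ₁` (with `ρ = σ/2`) then it holds for `σ₀ ≤ σ ≤ σ₁` and every `ρ ≥ σ/2`. [folklore] -/
theorem bounded_criterion_interpolate {t CM CA IA kl ku B σ₀ σ₁ σ ρ : ℝ} (hkl : 0 ≤ kl)
    (hIA : 0 ≤ IA) (hB : 0 ≤ B) (ht : 0 ≤ t)
    (h0 : t * (CM * (B ^ 2 - kl ^ 2 * σ₀) + 2 * B * (B * CA - kl * (σ₀ / 2) * IA)) ≤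
      B * (B ^ 2 - ku ^ 2 * σ₀))
    (h1 : t * (CM * (B ^ 2 - kl ^ 2 * σ₁) + 2 * B * (B * CA - kl * (σ₁ / 2) * IA)) ≤
      B * (B ^ 2 - ku ^ 2 * σ₁))
    (hσ0 : σ₀ ≤ σ) (hσ1 : σ ≤ σ₁) (hρ : σ / 2 ≤ ρ) :
    t * (CM * (B ^ 2 - kl ^ 2 * σ) + 2 * B * (B * CA - kl * ρ * IA)) ≤ B * (B ^ 2 - ku ^ 2 * σ) := by
  -- first on the curve
  have hcurve : t * (CM * (B ^ 2 - kl ^ 2 * σ) + 2 * B * (B * CA - kl * (σ / 2) * IA)) ≤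
      B * (B ^ 2 - ku ^ 2 * σ) := by
    rcases eq_or_lt_of_le (hσ0.trans hσ1) with heq | hlt
    · have hσ : σ = σ₀ := le_antisymm (heq ▸ hσ1) hσ0
      rw [hσ]; exact h0
    · have key : (σ₁ - σ₀) * (B * (B ^ 2 - ku ^ 2 * σ) -
          t * (CM * (B ^ 2 - kl ^ 2 * σ) + 2 * B * (B * CA - kl * (σ / 2) * IA))) =
          (σ₁ - σ) * (B * (B ^ 2 - ku ^ 2 * σ₀) -
            t * (CM * (B ^ 2 - kl ^ 2 * σ₀) + 2 * B * (B * CA - kl * (σ₀ / 2) * IA))) +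
          (σ - σ₀) * (B * (B ^ 2 - ku ^ 2 * σ₁) -
            t * (CM * (B ^ 2 - kl ^ 2 * σ₁) + 2 * B * (B * CA - kl * (σ₁ / 2) * IA))) := by
        ring
      have hnn : 0 ≤ (σ₁ - σ₀) * (B * (B ^ 2 - ku ^ 2 * σ) -
          t * (CM * (B ^ 2 - kl ^ 2 * σ) + 2 * B * (B * CA - kl * (σ / 2) * IA))) := by
        rw [key]
        exact add_nonneg (mul_nonneg (by linarith) (by linarith))
          (mul_nonneg (by linarith) (by linarith))
      have hpos : 0 < σ₁ - σ₀ := by linarith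
      have := nonneg_of_mul_nonneg_right (by rwa [mul_comm] at hnn) hpos
      linarith
  -- then off the curve
  have hgain : t * (2 * B * (B * CA - kl * ρ * IA)) ≤ t * (2 * B * (B * CA - kl * (σ / 2) * IA)) := by
    have : kl * (σ / 2) * IA ≤ kl * ρ * IA :=
      mul_le_mul_of_nonneg_right (mul_le_mul_of_nonneg_left hρ hkl) hIA
    exact mul_le_mul_of_nonneg_left (mul_le_mul_of_nonneg_left (by linarith) (by linarith)) ht
  have e1 : t * (CM * (B ^ 2 - kl ^ 2 * σ) + 2 * B * (B * CA - kl * ρ * IA)) =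
      t * (CM * (B ^ 2 - kl ^ 2 * σ)) + t * (2 * B * (B * CA - kl * ρ * IA)) := by ring
  have e2 : t * (CM * (B ^ 2 - kl ^ 2 * σ) + 2 * B * (B * CA - kl * (σ / 2) * IA)) =
      t * (CM * (B ^ 2 - kl ^ 2 * σ)) + t * (2 * B * (B * CA - kl * (σ / 2) * IA)) := by ring
  linarith

/-- `κ < B` from `κ ≤ ku·r`, `ku²·r² < B²` (`κ, ku, r ≥ 0`, `B > 0`). [folklore] -/
theorem lt_of_sq_bound {κ ku r B : ℝ} (hκ0 : 0 ≤ κ) (hκ : κ ≤ ku * r) (hB : 0 < B)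
    (h : ku ^ 2 * r ^ 2 < B ^ 2) : κ < B := by
  by_contra hle
  have hle' : B ≤ κ := not_lt.1 hle
  have h1 : B ^ 2 ≤ κ ^ 2 := pow_le_pow_left₀ hB.le hle' 2
  have h2 : κ ^ 2 ≤ (ku * r) ^ 2 := pow_le_pow_left₀ hκ0 hκ 2
  rw [mul_pow] at h2
  linarith

variable {q : ℕ}

/-- `0 ≤ Re(1 − χ(n))` (the values of `χ` lie in the closed unit disc). [folklore] -/
theorem re_one_sub_char_nonneg (χ : DirichletCharacter ℂ q) (n : ZMod q) : 0 ≤ (1 - χ n).re :=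
  le_trans (by positivity) (normSq_one_sub_half_le_re (χ.norm_le_one n))

/-- `‖1 − χ(3)‖² ≤ 4`. [folklore] -/
theorem normSq_one_sub_char_three_le_four (χ : DirichletCharacter ℂ q) :
    ‖1 - χ (3 : ZMod q)‖ ^ 2 ≤ 4 := by
  nlinarith [norm_one_sub_char_three_le χ, norm_nonneg (1 - χ (3 : ZMod q))]

/-! ## Lower bounds for `log q` -/

/-- `2.0794 ≤ log 8`. [folklore] -/
theorem log_eight_ge : (2.0794 : ℝ) ≤ Real.log 8 := by
  rw [show (8 : ℝ) = 2 ^ 3 by norm_num, Real.log_pow]; push_cast; linarith [Real.log_two_gt_d9]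

/-- `2.19722 ≤ log 9`. [folklore] -/
theorem log_nine_ge : (2.19722 : ℝ) ≤ Real.log 9 := by
  rw [show (9 : ℝ) = 3 ^ 2 by norm_num, Real.log_pow]; push_cast; linarith [Real.log_three_gt_d9]

/-- `2.3975 ≤ log 11` (`11⁷ = 19487171 > 19440000 = 2⁷·3⁵·5⁴`). [folklore] -/
theorem log_eleven_ge : (2.3975 : ℝ) ≤ Real.log 11 := by
  have h : Real.log 19440000 < Real.log 19487171 := Real.log_lt_log (by norm_num) (by norm_num)
  rw [show (19487171 : ℝ) = 11 ^ 7 by norm_num, Real.log_pow,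
    show (19440000 : ℝ) = 2 ^ 7 * 3 ^ 5 * 5 ^ 4 by norm_num, Real.log_mul (by norm_num) (by norm_num),
    Real.log_mul (by norm_num) (by norm_num), Real.log_pow, Real.log_pow, Real.log_pow] at h
  push_cast at h
  linarith [Real.log_two_gt_d9, Real.log_three_gt_d9, Real.log_five_gt_d9]

/-- `2.4849 ≤ log 12`. [folklore] -/
theorem log_twelve_ge : (2.4849 : ℝ) ≤ Real.log 12 := by
  rw [show (12 : ℝ) = 2 ^ 2 * 3 by norm_num, Real.log_mul (by norm_num) (by norm_num), Real.log_pow]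
  push_cast; linarith [Real.log_two_gt_d9, Real.log_three_gt_d9]

/-- `2.5634 ≤ log 13` (`13³ = 2197 > 2187 = 3⁷`; sharper than `log_thirteen_ge`). [folklore] -/
theorem log_thirteen_ge_sharp : (2.5634 : ℝ) ≤ Real.log 13 := by
  have h : Real.log 2187 < Real.log 2197 := Real.log_lt_log (by norm_num) (by norm_num)
  rw [show (2197 : ℝ) = 13 ^ 3 by norm_num, Real.log_pow, show (2187 : ℝ) = 3 ^ 7 by norm_num,
    Real.log_pow] at h
  push_cast at h
  linarith [Real.log_three_gt_d9]

/-- `2.70805 ≤ log 15`. [folklore] -/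
theorem log_fifteen_ge : (2.70805 : ℝ) ≤ Real.log 15 := by
  rw [show (15 : ℝ) = 3 * 5 by norm_num, Real.log_mul (by norm_num) (by norm_num)]
  linarith [Real.log_three_gt_d9, Real.log_five_gt_d9]

/-- `2.77258 ≤ log 16`. [folklore] -/
theorem log_sixteen_ge : (2.77258 : ℝ) ≤ Real.log 16 := by
  rw [show (16 : ℝ) = 2 ^ 4 by norm_num, Real.log_pow]; push_cast; linarith [Real.log_two_gt_d9]

/-- `2.8316 ≤ log 17` (`17⁵ = 1419857 > 1417176 = 2³·3¹¹`; sharper than `log_seventeen_ge`). [folklore] -/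
theorem log_seventeen_ge_sharp : (2.8316 : ℝ) ≤ Real.log 17 := by
  have h : Real.log 1417176 < Real.log 1419857 := Real.log_lt_log (by norm_num) (by norm_num)
  rw [show (1419857 : ℝ) = 17 ^ 5 by norm_num, Real.log_pow,
    show (1417176 : ℝ) = 2 ^ 3 * 3 ^ 11 by norm_num, Real.log_mul (by norm_num) (by norm_num),
    Real.log_pow, Real.log_pow] at h
  push_cast at h
  linarith [Real.log_two_gt_d9, Real.log_three_gt_d9]

/-- `2.8903 ≤ log 18`. [folklore] -/
theorem log_eighteen_ge : (2.8903 : ℝ) ≤ Real.log 18 := by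
  rw [show (18 : ℝ) = 2 * 3 ^ 2 by norm_num, Real.log_mul (by norm_num) (by norm_num), Real.log_pow]
  push_cast; linarith [Real.log_two_gt_d9, Real.log_three_gt_d9]

/-- `B ≤ log q` from `B ≤ log Q` and `Q ≤ q` (`0 < Q`). [folklore] -/
theorem le_log_of_le {B : ℝ} {Q q : ℕ} (hB : B ≤ Real.log Q) (hQ : 0 < Q) (hq : Q ≤ q) :
    B ≤ Real.log q :=
  hB.trans (Real.log_le_log (by exact_mod_cast hQ) (by exact_mod_cast hq))

/-! ## The master theorems at the two `ζ` rungs -/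

/-- **The rung `59/100` by the double reflection**, from the weighted bounded criteria at the TRUE values
`σ_n = ‖1 − χ(n)‖²`, `ρ_n = Re(1 − χ(n))` (`n = 2, 3`): budgets `B₂ + B₃ ≤ B ≤ log q`, weights
`t₂ + t₃ ≥ 2`, `0.49014²σ₂ < B₂²`, `0.6343²σ₃ < B₃²`, constants `fiftynine_constants(_three)`.
[cite: Weil1952FormulesExplicites, the «lemme» p. 262; Yoshida1992 §6] -/
theorem weilPositivityOnChar_fiftynine_of_double [NeZero q] (hq1 : q ≠ 1)
    (χ : DirichletCharacter ℂ q) {B B₂ B₃ t₂ t₃ : ℝ} (hBq : B ≤ Real.log q) (hBB : B₂ + B₃ ≤ B)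
    (hB₂ : 0 < B₂) (hB₃ : 0 < B₃) (ht₂ : 0 ≤ t₂) (ht₃ : 0 ≤ t₃) (ht : 2 ≤ t₂ + t₃)
    (hσ₂ : 0.49014 ^ 2 * ‖1 - χ (2 : ZMod q)‖ ^ 2 < B₂ ^ 2)
    (hσ₃ : 0.6343 ^ 2 * ‖1 - χ (3 : ZMod q)‖ ^ 2 < B₃ ^ 2)
    (h₂ : t₂ * (0.206478 * (B₂ ^ 2 - 0.49012 ^ 2 * ‖1 - χ (2 : ZMod q)‖ ^ 2) +
        2 * B₂ * (B₂ * 0.504178 - 0.49012 * (1 - χ (2 : ZMod q)).re * 0.504029)) ≤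
      B₂ * (B₂ ^ 2 - 0.49014 ^ 2 * ‖1 - χ (2 : ZMod q)‖ ^ 2))
    (h₃ : t₃ * (1.03945 * (B₃ ^ 2 - 0.63428 ^ 2 * ‖1 - χ (3 : ZMod q)‖ ^ 2) +
        2 * B₃ * (B₃ * 0.087697 - 0.63428 * (1 - χ (3 : ZMod q)).re * 0.087693)) ≤
      B₃ * (B₃ ^ 2 - 0.6343 ^ 2 * ‖1 - χ (3 : ZMod q)‖ ^ 2)) :
    WeilPositivityOnChar χ (59 / 100) := by
  obtain ⟨hCM₂, hCA₂, hIA₂⟩ := fiftynine_constants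
  obtain ⟨hCM₃, hCA₃, hIA₃⟩ := fiftynine_constants_three
  obtain ⟨hk1, hk2⟩ := kprime_bounds
  have hj1 := kthree_ge
  have hj2 := kthree_le
  set k₂ := Real.log 2 / Real.sqrt 2 with hk₂
  set k₃ := Real.log 3 / Real.sqrt 3 with hk₃
  set u₂ : ℂ := 1 - χ (2 : ZMod q) with hu₂
  set u₃ : ℂ := 1 - χ (3 : ZMod q) with hu₃
  have hρ₂ : 0 ≤ u₂.re := re_one_sub_char_nonneg χ 2
  have hρ₃ : 0 ≤ u₃.re := re_one_sub_char_nonneg χ 3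
  have hcrit₂ := cleared_criterion_of_bounds (t := t₂) (ρ := u₂.re) (σ := ‖u₂‖ ^ 2) hCM₂ hCA₂ hIA₂
    (by norm_num) hρ₂ (sq_nonneg _) hk1 hk2 (by norm_num) hB₂ (by norm_num) ht₂ hσ₂.le h₂
  have hcrit₃ := cleared_criterion_of_bounds (t := t₃) (ρ := u₃.re) (σ := ‖u₃‖ ^ 2) hCM₃ hCA₃ hIA₃
    (by norm_num) hρ₃ (sq_nonneg _) hj1 hj2 (by norm_num) hB₃ (by norm_num) ht₃ hσ₃.le h₃
  have hκ₂ : k₂ * ‖u₂‖ < B₂ :=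
    lt_of_sq_bound (mul_nonneg (by linarith) (norm_nonneg _))
      (mul_le_mul_of_nonneg_right hk2 (norm_nonneg _)) hB₂ hσ₂
  have hκ₃ : k₃ * ‖u₃‖ < B₃ :=
    lt_of_sq_bound (mul_nonneg (by linarith) (norm_nonneg _))
      (mul_le_mul_of_nonneg_right hj2 (norm_nonneg _)) hB₃ hσ₃
  have hl2 := Real.log_two_gt_d9
  have hl3 := Real.log_three_lt_d9
  refine weilPositivityOnChar_transfer_double_reflection (B := B) (B₂ := B₂) (B₃ := B₃)
    (κ₂ := k₂ * ‖u₂‖) (κ₃ := k₃ * ‖u₃‖) (t₂ := t₂) (t₃ := t₃) (by linarith) (by linarith)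
    weilPositivityOn_59_100 hq1 χ hBq hBB (by rw [hk₂, hu₂]) (by rw [hk₃, hu₃]) hκ₂ hκ₃ ht₂ ht₃ ht
    rfl rfl rfl rfl rfl rfl rfl rfl ?_ ?_
  · rw [mul_pow]; exact hcrit₂
  · rw [mul_pow]; exact hcrit₃

/-- **The rung `log 2` by the double reflection** (constants `log_two_constants(_three)`; `ζ` rung
`EvenWinsBeyondArch.weilPositivityOn_log_two`). [cite: Weil1952FormulesExplicites, the «lemme» p. 262; Yoshida1992 §6] -/
theorem weilPositivityOnChar_log_two_of_double [NeZero q] (hq1 : q ≠ 1)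
    (χ : DirichletCharacter ℂ q) {B B₂ B₃ t₂ t₃ : ℝ} (hBq : B ≤ Real.log q) (hBB : B₂ + B₃ ≤ B)
    (hB₂ : 0 < B₂) (hB₃ : 0 < B₃) (ht₂ : 0 ≤ t₂) (ht₃ : 0 ≤ t₃) (ht : 2 ≤ t₂ + t₃)
    (hσ₂ : 0.49014 ^ 2 * ‖1 - χ (2 : ZMod q)‖ ^ 2 < B₂ ^ 2)
    (hσ₃ : 0.6343 ^ 2 * ‖1 - χ (3 : ZMod q)‖ ^ 2 < B₃ ^ 2)
    (h₂ : t₂ * (0 * (B₂ ^ 2 - 0.49012 ^ 2 * ‖1 - χ (2 : ZMod q)‖ ^ 2) +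
        2 * B₂ * (B₂ * 0.721574 - 0.49012 * (1 - χ (2 : ZMod q)).re * 0.721149)) ≤
      B₂ * (B₂ ^ 2 - 0.49014 ^ 2 * ‖1 - χ (2 : ZMod q)‖ ^ 2))
    (h₃ : t₃ * (0.82214 * (B₃ ^ 2 - 0.63428 ^ 2 * ‖1 - χ (3 : ZMod q)‖ ^ 2) +
        2 * B₃ * (B₃ * 0.31051 - 0.63428 * (1 - χ (3 : ZMod q)).re * 0.31043)) ≤
      B₃ * (B₃ ^ 2 - 0.6343 ^ 2 * ‖1 - χ (3 : ZMod q)‖ ^ 2)) :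
    WeilPositivityOnChar χ (Real.log 2) := by
  obtain ⟨hCM₂, hCA₂, hIA₂⟩ := log_two_constants
  obtain ⟨hCM₃, hCA₃, hIA₃⟩ := log_two_constants_three
  obtain ⟨hk1, hk2⟩ := kprime_bounds
  have hj1 := kthree_ge
  have hj2 := kthree_le
  set k₂ := Real.log 2 / Real.sqrt 2 with hk₂
  set k₃ := Real.log 3 / Real.sqrt 3 with hk₃
  set u₂ : ℂ := 1 - χ (2 : ZMod q) with hu₂
  set u₃ : ℂ := 1 - χ (3 : ZMod q) with hu₃
  have hρ₂ : 0 ≤ u₂.re := re_one_sub_char_nonneg χ 2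
  have hρ₃ : 0 ≤ u₃.re := re_one_sub_char_nonneg χ 3
  have hcrit₂ := cleared_criterion_of_bounds (t := t₂) (ρ := u₂.re) (σ := ‖u₂‖ ^ 2) hCM₂ hCA₂ hIA₂
    (by norm_num) hρ₂ (sq_nonneg _) hk1 hk2 (by norm_num) hB₂ le_rfl ht₂ hσ₂.le h₂
  have hcrit₃ := cleared_criterion_of_bounds (t := t₃) (ρ := u₃.re) (σ := ‖u₃‖ ^ 2) hCM₃ hCA₃ hIA₃
    (by norm_num) hρ₃ (sq_nonneg _) hj1 hj2 (by norm_num) hB₃ (by norm_num) ht₃ hσ₃.le h₃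
  have hκ₂ : k₂ * ‖u₂‖ < B₂ :=
    lt_of_sq_bound (mul_nonneg (by linarith) (norm_nonneg _))
      (mul_le_mul_of_nonneg_right hk2 (norm_nonneg _)) hB₂ hσ₂
  have hκ₃ : k₃ * ‖u₃‖ < B₃ :=
    lt_of_sq_bound (mul_nonneg (by linarith) (norm_nonneg _))
      (mul_le_mul_of_nonneg_right hj2 (norm_nonneg _)) hB₃ hσ₃
  have hlog23 : Real.log 3 < 2 * Real.log 2 := by
    linarith [Real.log_two_gt_d9, Real.log_three_lt_d9]
  refine weilPositivityOnChar_transfer_double_reflection (B := B) (B₂ := B₂) (B₃ := B₃)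
    (κ₂ := k₂ * ‖u₂‖) (κ₃ := k₃ * ‖u₃‖) (t₂ := t₂) (t₃ := t₃) hlog23 le_rfl
    Summit.RiemannHypothesis.RiemannHypothesis.Theorems.EvenWinsBeyondArch.weilPositivityOn_log_two
    hq1 χ hBq hBB (by rw [hk₂, hu₂]) (by rw [hk₃, hu₃]) hκ₂ hκ₃ ht₂ ht₃ ht
    rfl rfl rfl rfl rfl rfl rfl rfl ?_ ?_
  · rw [mul_pow]; exact hcrit₂
  · rw [mul_pow]; exact hcrit₃

/-! ## The two uniform statements -/

/-- **Every Dirichlet character mod `q ≥ 12`, rung `59/100`** — `q ≥ 12`, EVERY Dirichlet character; double reflection with `B = 2.4849`, `B₂ = 1.2149`, `B₃ = 1.27`, `t₂ = 0.984`, `t₃ = 1.016`. [cite: Weil1952FormulesExplicites, the «lemme» p. 262; Yoshida1992 §6] -/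
theorem weilPositivityOnChar_fiftynine_of_ge_twelve (hq : 12 ≤ q) (χ : DirichletCharacter ℂ q) :
    WeilPositivityOnChar χ (59 / 100) := by
  have hq1 : q ≠ 1 := by omega
  haveI : NeZero q := ⟨by omega⟩
  have hBq : (2.4849 : ℝ) ≤ Real.log q := le_log_of_le log_twelve_ge (by norm_num) hq
  exact weilPositivityOnChar_fiftynine_of_double hq1 χ hBq (B₂ := 1.2149) (B₃ := 1.27) (t₂ := 0.984) (t₃ := 1.016)
    (by norm_num) (by norm_num) (by norm_num) (by norm_num) (by norm_num) (by norm_num)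
    (by nlinarith [(sq_nonneg ‖1 - χ (2 : ZMod q)‖), (normSq_one_sub_char_le_four χ)])
    (by nlinarith [(sq_nonneg ‖1 - χ (3 : ZMod q)‖), (normSq_one_sub_char_three_le_four χ)])
    (bounded_criterion_interpolate (by norm_num) (by norm_num) (by norm_num) (by norm_num)
      (by norm_num :
        (0.984 : ℝ) * (0.206478 * ((1.2149 : ℝ) ^ 2 - 0.49012 ^ 2 * 0) +
          2 * 1.2149 * (1.2149 * 0.504178 - 0.49012 * ((0 : ℝ) / 2) * 0.504029)) ≤
        1.2149 * ((1.2149 : ℝ) ^ 2 - 0.49014 ^ 2 * 0))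
      (by norm_num :
        (0.984 : ℝ) * (0.206478 * ((1.2149 : ℝ) ^ 2 - 0.49012 ^ 2 * 4) +
          2 * 1.2149 * (1.2149 * 0.504178 - 0.49012 * ((4 : ℝ) / 2) * 0.504029)) ≤
        1.2149 * ((1.2149 : ℝ) ^ 2 - 0.49014 ^ 2 * 4))
      (sq_nonneg _) (normSq_one_sub_char_le_four χ) (normSq_one_sub_half_le_re (χ.norm_le_one _)))
    (bounded_criterion_interpolate (by norm_num) (by norm_num) (by norm_num) (by norm_num)
      (by norm_num :
        (1.016 : ℝ) * (1.03945 * ((1.27 : ℝ) ^ 2 - 0.63428 ^ 2 * 0) +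
          2 * 1.27 * (1.27 * 0.087697 - 0.63428 * ((0 : ℝ) / 2) * 0.087693)) ≤
        1.27 * ((1.27 : ℝ) ^ 2 - 0.6343 ^ 2 * 0))
      (by norm_num :
        (1.016 : ℝ) * (1.03945 * ((1.27 : ℝ) ^ 2 - 0.63428 ^ 2 * 4) +
          2 * 1.27 * (1.27 * 0.087697 - 0.63428 * ((4 : ℝ) / 2) * 0.087693)) ≤
        1.27 * ((1.27 : ℝ) ^ 2 - 0.6343 ^ 2 * 4))
      (sq_nonneg _) (normSq_one_sub_char_three_le_four χ) (normSq_one_sub_half_le_re (χ.norm_le_one _)))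

/-- **Every Dirichlet character mod `q ≥ 18`, rung `log 2`** — `q ≥ 18`, EVERY Dirichlet character; double reflection with `B = 2.8903`, `B₂ = 1.6203`, `B₃ = 1.27`, `t₂ = 1.121`, `t₃ = 0.879`. [cite: Weil1952FormulesExplicites, the «lemme» p. 262; Yoshida1992 §6] -/
theorem weilPositivityOnChar_log_two_of_ge_eighteen (hq : 18 ≤ q) (χ : DirichletCharacter ℂ q) :
    WeilPositivityOnChar χ (Real.log 2) := by
  have hq1 : q ≠ 1 := by omega
  haveI : NeZero q := ⟨by omega⟩
  have hBq : (2.8903 : ℝ) ≤ Real.log q := le_log_of_le log_eighteen_ge (by norm_num) hq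
  exact weilPositivityOnChar_log_two_of_double hq1 χ hBq (B₂ := 1.6203) (B₃ := 1.27) (t₂ := 1.121) (t₃ := 0.879)
    (by norm_num) (by norm_num) (by norm_num) (by norm_num) (by norm_num) (by norm_num)
    (by nlinarith [(sq_nonneg ‖1 - χ (2 : ZMod q)‖), (normSq_one_sub_char_le_four χ)])
    (by nlinarith [(sq_nonneg ‖1 - χ (3 : ZMod q)‖), (normSq_one_sub_char_three_le_four χ)])
    (bounded_criterion_interpolate (by norm_num) (by norm_num) (by norm_num) (by norm_num)
      (by norm_num :
        (1.121 : ℝ) * (0 * ((1.6203 : ℝ) ^ 2 - 0.49012 ^ 2 * 0) +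
          2 * 1.6203 * (1.6203 * 0.721574 - 0.49012 * ((0 : ℝ) / 2) * 0.721149)) ≤
        1.6203 * ((1.6203 : ℝ) ^ 2 - 0.49014 ^ 2 * 0))
      (by norm_num :
        (1.121 : ℝ) * (0 * ((1.6203 : ℝ) ^ 2 - 0.49012 ^ 2 * 4) +
          2 * 1.6203 * (1.6203 * 0.721574 - 0.49012 * ((4 : ℝ) / 2) * 0.721149)) ≤
        1.6203 * ((1.6203 : ℝ) ^ 2 - 0.49014 ^ 2 * 4))
      (sq_nonneg _) (normSq_one_sub_char_le_four χ) (normSq_one_sub_half_le_re (χ.norm_le_one _)))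
    (bounded_criterion_interpolate (by norm_num) (by norm_num) (by norm_num) (by norm_num)
      (by norm_num :
        (0.879 : ℝ) * (0.82214 * ((1.27 : ℝ) ^ 2 - 0.63428 ^ 2 * 0) +
          2 * 1.27 * (1.27 * 0.31051 - 0.63428 * ((0 : ℝ) / 2) * 0.31043)) ≤
        1.27 * ((1.27 : ℝ) ^ 2 - 0.6343 ^ 2 * 0))
      (by norm_num :
        (0.879 : ℝ) * (0.82214 * ((1.27 : ℝ) ^ 2 - 0.63428 ^ 2 * 4) +
          2 * 1.27 * (1.27 * 0.31051 - 0.63428 * ((4 : ℝ) / 2) * 0.31043)) ≤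
        1.27 * ((1.27 : ℝ) ^ 2 - 0.6343 ^ 2 * 4))
      (sq_nonneg _) (normSq_one_sub_char_three_le_four χ) (normSq_one_sub_half_le_re (χ.norm_le_one _)))

end Summit.Ventures.WeilGRH
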